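import Summits.KontsevichZagierPeriods.KontsevichZagierPeriods.Theorems.LinRedNormalFormArrangementNormalFormStubRebaseSimpleZeroNestedDiffE2Box
import Summits.KontsevichZagierPeriods.KontsevichZagierPeriods.Theorems.LinRedNormalFormArrangementNormalFormStubRebaseSimpleZeroNestedDiffE2Edge
import Summits.KontsevichZagierPeriods.KontsevichZagierPeriods.Theorems.LinRedNormalFormArrangementNormalFormStubRebaseSimpleZeroNestedDiffE2Corner
import Summits.KontsevichZagierPeriods.KontsevichZagierPeriods.Theorems.LinRedNormalFormArrangementNormalFormStubRebaseSimpleZeroNestedDiffE2Blow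

/-!
# Stub `stub_rebaseSimpleZeroTwo`, part `HPar1` (crux `ArrangementNormalForm`, line `janus-bands`)
— brick `NestedDiffE2Pieces`

**The pieces of the E2 dissection, on data of the normalised frame.** A datum of the interval
normal form (`RebaseE1.IsDN`) is in the NORMALISED FRAME when its top is a constant `τ`, its outer
letter is a constant `κ` and its inner letter `cᵢ` has slope `λ ≠ 0` (simple base pole `r`, wall
`ρ = cᵢ(r)`). This brick closes the building blocks of the case analysis of such data by the landed
bricks: `RebaseE2.good_gap` (wall at a positive distance, `RebaseDiff.good_coreA`),
`RebaseE2.good_blow_const` (constant bottom AT the wall height, base blow-up `RebaseDiff.good_blow`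
with `blow_qA_const`), `RebaseE2.good_blow_centre` (top = wall and bottom through the centre
`(r, ρ)`: base blow-up with `blow_qA_centre`), `RebaseE2.good_corner` (bottom above the wall,
touching it at an end of the interval: `RebaseDiff.good_coreA_corner`), `RebaseE2.good_lower`
(top = wall, pole at a positive distance: `RebaseDiff.good_coreA_edge'`); and the small facts
feeding their hypotheses (`outer_side`, `exists_alt`, `exists_dom`, `margin_y`, `exists_εy`).
Registered: `rebaseSimpleZero_e2Lower`.

References: M. Kontsevich, D. Zagier, *Periods* (2001), §1.2, rules (1a), (1b), (2).
-/

noncomputable section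

open Set MeasureTheory MvPolynomial
open Literature.NumberTheory.Transcendental Literature.ModelTheory.ExponentialFields

namespace Summit.KontsevichZagierPeriods.ArrangementNormalForm.JanusBands

namespace RebaseE2

open SeparatePos RebasePos RebaseZero RebaseNest RebaseDiff RebaseE1

variable {i j : Fin 2} {s : KZ.IntegralRep (0 + 1 + 2)} {l u : ℚ} {A B : Cf} {τ : ℚ} {T : BData}
  {p : MvPolynomial (Fin 0) ℚ} {a : Fin 2 → Option Cf} {ci cj : Cf}

/-! ### Small facts -/

/-- Value of a constant atom. -/
theorem ev_mk0 (τ : ℚ) (y : ℝ) : ev (mk 0 τ) y = τ := by rw [ev_mk, Rat.cast_zero, zero_mul, zero_add]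

/-- **The outer letter line lies weakly below `A` or weakly above `B`** on the whole open interval
(non-zero base constant; any slopes). [Zagier 1994, §9] -/
theorem outer_side (h : IsDN s l u A B T p a i j) (hi : a i = some ci) (hj : a j = some cj) (h1 : T.n₁ = 0)
    (hn : T.n₂ = 1) (hK : Kc T p ≠ 0) :
    (∀ y : ℝ, (l : ℝ) < y → y < u → ev cj y ≤ ev A y) ∨ (∀ y : ℝ, (l : ℝ) < y → y < u → ev B y ≤ ev cj y) := by
  obtain ⟨-, hnej⟩ := letter_ne_of_integrableOn h.ne _ A B T p a ci cj hi hj h1 hn hK h.integrableOn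
  obtain ⟨ε, hε, hP⟩ := exists_letter_sign h.ne _ A B j cj hnej
  rw [← h.dom] at hP
  rcases hε with rfl | rfl
  · refine Or.inl fun y hy1 hy2 => ?_
    by_contra hlt
    push Not at hlt
    set m := min (ev cj y) (ev B y) with hm
    have hAm : ev A y < m := lt_min hlt (h.AB y hy1 hy2)
    have hm1 := min_le_left (ev cj y) (ev B y)
    have hm2 := min_le_right (ev cj y) (ev B y)
    have hz : pt i j y ((ev A y + (ev A y + m) / 2) / 2) ((ev A y + m) / 2) ∈ s.domain := by
      rw [h.mem, yv_pt, tv_pt_i h.ne, tv_pt_j]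
      exact ⟨⟨hy1, hy2⟩, by linarith, by linarith, by linarith⟩
    have := hP _ hz
    rw [yv_pt, tv_pt_j, one_mul] at this
    linarith
  · refine Or.inr fun y hy1 hy2 => ?_
    by_contra hlt
    push Not at hlt
    set m := max (ev cj y) (ev A y) with hm
    have hmB : m < ev B y := max_lt hlt (h.AB y hy1 hy2)
    have hm1 := le_max_left (ev cj y) (ev A y)
    have hm2 := le_max_right (ev cj y) (ev A y)
    have hz : pt i j y ((ev A y + (m + ev B y) / 2) / 2) ((m + ev B y) / 2) ∈ s.domain := by
      rw [h.mem, yv_pt, tv_pt_i h.ne, tv_pt_j]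
      exact ⟨⟨hy1, hy2⟩, by linarith, by linarith, by linarith⟩
    have := hP _ hz
    rw [yv_pt, tv_pt_j] at this
    linarith

/-- **The alternative for the outer letter under a wall.** For `κ ≠ ρ` there is `m₀ > 0` with
`m₀ ≤ |tⱼ − κ| ∨ m₀ ≤ ρ − tᵢ` whenever `tᵢ < tⱼ < ρ`. -/
theorem exists_alt {κ ρ : ℝ} (hκ : κ ≠ ρ) :
    ∃ m₀ : ℝ, 0 < m₀ ∧ ∀ ti tj : ℝ, ti < tj → tj < ρ → m₀ ≤ |tj - κ| ∨ m₀ ≤ ρ - ti := by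
  rcases lt_or_gt_of_ne hκ with h | h
  · refine ⟨(ρ - κ) / 2, by linarith, fun ti tj h1 h2 => ?_⟩
    by_cases hc : (ρ - κ) / 2 ≤ tj - κ
    · exact Or.inl (hc.trans (le_abs_self _))
    · push Not at hc
      exact Or.inr (by linarith)
  · refine ⟨κ - ρ, by linarith, fun ti tj _ h2 => Or.inl ?_⟩
    rw [abs_sub_comm, abs_of_pos (by linarith)]
    linarith

/-- **Domination of the outer letter above a wall.** If `κ ≤ ρ` or `τ < κ` there is `C` with
`tⱼ − ρ ≤ C |tⱼ − κ|` whenever `ρ < tⱼ < τ`. -/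
theorem exists_dom {κ ρ τ : ℝ} (h : κ ≤ ρ ∨ τ < κ) :
    ∃ C : ℝ, ∀ tj : ℝ, ρ < tj → tj < τ → tj - ρ ≤ C * |tj - κ| := by
  rcases h with h | h
  · exact ⟨1, fun tj h1 _ => by rw [one_mul, abs_of_pos (by linarith)]; linarith⟩
  · refine ⟨(τ - ρ) / (κ - τ), fun tj h1 h2 => ?_⟩
    have hk : 0 < κ - τ := by linarith
    rw [abs_sub_comm, abs_of_pos (by linarith)]
    calc tj - ρ ≤ τ - ρ := by linarith
      _ = (τ - ρ) / (κ - τ) * (κ - τ) := by field_simp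
      _ ≤ (τ - ρ) / (κ - τ) * (κ - tj) :=
          mul_le_mul_of_nonneg_left (by linarith) (div_nonneg (by linarith) hk.le)

/-- The base pole keeps a positive distance from the open interval once it is not an end. -/
theorem margin_y (h : IsDN s l u A B T p a i j) (hl : T.ℓ₂.2 ≠ l) (hu : T.ℓ₂.2 ≠ u) :
    ∃ my : ℝ, 0 < my ∧ ∀ y : ℝ, (l : ℝ) < y → y < u → my ≤ |y - T.ℓ₂.2| := by
  rcases h.pole with hp | hp
  · have hlt : (T.ℓ₂.2 : ℝ) < l := by exact_mod_cast lt_of_le_of_ne hp hl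
    refine ⟨l - T.ℓ₂.2, by linarith, fun y h1 _ => ?_⟩
    rw [abs_of_pos (by linarith)]
    linarith
  · have hlt : (u : ℝ) < T.ℓ₂.2 := by exact_mod_cast lt_of_le_of_ne hp (Ne.symm hu)
    refine ⟨(T.ℓ₂.2 : ℝ) - u, by linarith, fun y _ h2 => ?_⟩
    rw [abs_of_neg (by linarith)]
    linarith

/-- The sign of `y − r` on the open interval. -/
theorem exists_εy (h : IsDN s l u A B T p a i j) :
    ∃ εy : ℚ, (εy = 1 ∨ εy = -1) ∧ ∀ y : ℝ, (l : ℝ) < y → y < u → 0 < (εy : ℝ) * (y - T.ℓ₂.2) := by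
  rcases h.pole with hp | hp
  · have hle : (T.ℓ₂.2 : ℝ) ≤ l := by exact_mod_cast hp
    exact ⟨1, Or.inl rfl, fun y h1 _ => by push_cast; linarith⟩
  · have hle : (u : ℝ) ≤ T.ℓ₂.2 := by exact_mod_cast hp
    exact ⟨-1, Or.inr rfl, fun y _ h2 => by push_cast; linarith⟩

/-- The inner letter is off the domain (non-zero base constant). -/
theorem tv_ne_inner (h : IsDN s l u A B T p a i j) (hi : a i = some ci) (hj : a j = some cj) (h1 : T.n₁ = 0)
    (hn : T.n₂ = 1) (hK : Kc T p ≠ 0) : ∀ z ∈ s.domain, tv z i ≠ ev ci (yv z) := by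
  have key := (letter_ne_of_integrableOn h.ne _ A B T p a ci cj hi hj h1 hn hK h.integrableOn).1
  rwa [← h.dom] at key

/-! ### The pieces -/

/-- **A wall at a positive distance** (the normalised `good_typeA_gap`): if `|tᵢ − ρ| ≥ g > 0` on
the domain of a datum in the normalised frame, the datum is good (`RebaseDiff.good_coreA` with the
domination constant `P/g`, `P` a bound of the inner letter form). [Kontsevich–Zagier 2001, §1.2] -/
theorem good_gap (h : IsDN s l u A (mk 0 τ) T p a i j) (hi : a i = some ci) (hj : a j = some cj)
    (hcj : cj.1 (Fin.last 0) = 0) (hlam : ci.1 (Fin.last 0) ≠ 0) (h1 : T.n₁ = 0) (hn : T.n₂ = 1)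
    (hK : Kc T p ≠ 0) (ρ : ℚ) (hρ : ρ = ci.2 - (0 - ci.1 (Fin.last 0)) * T.ℓ₂.2) (g : ℝ) (hg : 0 < g)
    (hgap : ∀ z ∈ s.domain, g ≤ |tv z i - ρ|) : Good 2 (KZ.of s) := by
  have hrot : rot ci 0 T.ℓ₂.2 = mk 0 ρ := by rw [hρ]; rfl
  obtain ⟨P, hP, hPle⟩ := exists_letter_bound s h.bdd i ci
  refine good_coreA s h.ne _ A τ T p a ci cj hi hj hcj h1 hn hlam h.bdd h.dom h.int (tv_ne_inner h hi hj h1 hn hK)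
    (fun z hz => h.yv_ne ((h.mem z).1 hz).1.1 ((h.mem z).1 hz).1.2) (P / g) fun z hz => ?_
  rw [hrot, ev_mk0]
  calc |tv z i - ev ci (yv z)| ≤ P := hPle z hz
    _ = P / g * g := (div_mul_cancel₀ P hg.ne').symm
    _ ≤ P / g * |tv z i - ρ| := mul_le_mul_of_nonneg_left (hgap z hz) (by positivity)

/-- **The wall strictly above the top**: gap `ρ − τ`. -/
theorem good_gap_top (h : IsDN s l u A (mk 0 τ) T p a i j) (hi : a i = some ci) (hj : a j = some cj)
    (hcj : cj.1 (Fin.last 0) = 0) (hlam : ci.1 (Fin.last 0) ≠ 0) (h1 : T.n₁ = 0) (hn : T.n₂ = 1)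
    (hK : Kc T p ≠ 0) (ρ : ℚ) (hρ : ρ = ci.2 - (0 - ci.1 (Fin.last 0)) * T.ℓ₂.2) (hτρ : (τ : ℝ) < ρ) :
    Good 2 (KZ.of s) := by
  refine good_gap h hi hj hcj hlam h1 hn hK ρ hρ ((ρ : ℝ) - τ) (by linarith) fun z hz => ?_
  obtain ⟨-, -, hij', hB'⟩ := (h.mem z).1 hz
  rw [ev_mk0] at hB'
  rw [abs_of_neg (by linarith)]
  linarith

/-- **The wall strictly below the bottom at both ends**: gap `min(A(l), A(u)) − ρ`. -/
theorem good_gap_ends (h : IsDN s l u A (mk 0 τ) T p a i j) (hi : a i = some ci) (hj : a j = some cj)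
    (hcj : cj.1 (Fin.last 0) = 0) (hlam : ci.1 (Fin.last 0) ≠ 0) (h1 : T.n₁ = 0) (hn : T.n₂ = 1)
    (hK : Kc T p ≠ 0) (ρ : ℚ) (hρ : ρ = ci.2 - (0 - ci.1 (Fin.last 0)) * T.ℓ₂.2) (hl : (ρ : ℝ) < ev A l)
    (hu : (ρ : ℝ) < ev A u) : Good 2 (KZ.of s) := by
  refine good_gap h hi hj hcj hlam h1 hn hK ρ hρ (min (ev A l) (ev A u) - ρ) (by rw [sub_pos]; exact lt_min hl hu)
    fun z hz => ?_
  obtain ⟨⟨h1', h2'⟩, hA', -, -⟩ := (h.mem z).1 hz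
  have hmin := min_ends_le_ev A h.lu h1'.le h2'.le
  have hmin0 := lt_min hl hu
  rw [abs_of_pos (by linarith)]
  linarith

/-- **A constant bottom at the wall height** (`A ≡ ρ < τ`, pole at a positive distance): base
blow-up with the bottom read verbatim (`RebaseDiff.good_blow`, `RebaseDiff.blow_qA_const`); the
nest lies above the wall, in the cone `tᵢ − ρ ≤ ((τ − ρ)/m_y) |y − r|`.
[Kontsevich–Zagier 2001, §1.2, rule (2)] -/
theorem good_blow_const (h : IsDN s l u A (mk 0 τ) T p a i j) (hi : a i = some ci) (hj : a j = some cj)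
    (hcj : cj.1 (Fin.last 0) = 0) (h1 : T.n₁ = 0) (hn : T.n₂ = 1) (hA0 : A.1 (Fin.last 0) = 0) (ρ : ℚ)
    (hρ : ρ = ci.2 - (0 - ci.1 (Fin.last 0)) * T.ℓ₂.2) (hA2 : (A.2 : ℝ) = ρ) (my : ℝ) (hmy : 0 < my)
    (hregy : ∀ y : ℝ, (l : ℝ) < y → y < u → my ≤ |y - T.ℓ₂.2|) : Good 2 (KZ.of s) := by
  obtain ⟨εy, -, hyε⟩ := exists_εy h
  have hAv : ∀ y : ℝ, ev A y = ρ := fun y => by rw [ev_of_fst_eq_zero hA0, hA2]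
  refine good_blow s h.ne _ A τ T p a ci cj hi hj hcj h1 hn h.bdd h.dom h.int ρ hρ 1 εy (Or.inl rfl)
    (fun z hz => ?_) (fun z hz => ?_) ((τ - ρ) / my) (fun z hz => ?_) (Sum.inr A, Sum.inl i)
    (blow_qA_const i A hA0 ρ T.ℓ₂.2 1 (1 * εy))
  · obtain ⟨-, hA', -, -⟩ := (h.mem z).1 hz
    rw [hAv] at hA'
    push_cast
    linarith
  · obtain ⟨⟨h1', h2'⟩, -⟩ := (h.mem z).1 hz
    exact hyε _ h1' h2'
  · obtain ⟨⟨h1', h2'⟩, hA', hij', hB'⟩ := (h.mem z).1 hz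
    rw [hAv] at hA'
    rw [ev_mk0] at hB'
    have hm := hregy _ h1' h2'
    rw [abs_of_pos (by linarith)]
    calc tv z i - ρ ≤ τ - ρ := by linarith
      _ = (τ - ρ) / my * my := by field_simp
      _ ≤ (τ - ρ) / my * |yv z - T.ℓ₂.2| := mul_le_mul_of_nonneg_left hm (div_nonneg (by linarith) hmy.le)

/-- **Top = wall, bottom through the centre `(r, ρ)`** (the pinch of the band at a pole end
under the wall): base blow-up with the bottom read as a pure base row (`RebaseDiff.good_blow`,
`RebaseDiff.blow_qA_centre`); the nest lies below the wall, in the cone `ρ − tᵢ ≤ |A′| |y − r|`.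
[Kontsevich–Zagier 2001, §1.2, rule (2)] -/
theorem good_blow_centre (h : IsDN s l u A (mk 0 τ) T p a i j) (hi : a i = some ci) (hj : a j = some cj)
    (hcj : cj.1 (Fin.last 0) = 0) (h1 : T.n₁ = 0) (hn : T.n₂ = 1) (ρ : ℚ)
    (hρ : ρ = ci.2 - (0 - ci.1 (Fin.last 0)) * T.ℓ₂.2) (hτρ : τ = ρ)
    (hAr : A.1 (Fin.last 0) * T.ℓ₂.2 + A.2 = ρ) : Good 2 (KZ.of s) := by
  obtain ⟨εy, hεy, hyε⟩ := exists_εy h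
  have hτρ' : (τ : ℝ) = ρ := by exact_mod_cast hτρ
  have hArv : ev A T.ℓ₂.2 = ρ := by rw [ev]; exact_mod_cast hAr
  refine good_blow s h.ne _ A τ T p a ci cj hi hj hcj h1 hn h.bdd h.dom h.int ρ hρ (-1) εy (Or.inr rfl)
    (fun z hz => ?_) (fun z hz => ?_) |(A.1 (Fin.last 0) : ℝ)| (fun z hz => ?_)
    (cmpLin i 0 εy (-(εy * A.1 (Fin.last 0)))) (blow_qA_centre i A ρ T.ℓ₂.2 (-1) εy (Or.inr rfl) hεy hAr)
  · obtain ⟨-, -, hij', hB'⟩ := (h.mem z).1 hz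
    rw [ev_mk0] at hB'
    push_cast
    linarith
  · obtain ⟨⟨h1', h2'⟩, -⟩ := (h.mem z).1 hz
    exact hyε _ h1' h2'
  · obtain ⟨-, hA', hij', hB'⟩ := (h.mem z).1 hz
    rw [ev_mk0] at hB'
    have e : (ρ : ℝ) - ev A (yv z) = (A.1 (Fin.last 0) : ℝ) * (T.ℓ₂.2 - yv z) := by rw [← hArv, ev, ev]; ring
    rw [abs_of_neg (by linarith)]
    calc -(tv z i - ρ) ≤ ρ - ev A (yv z) := by linarith
      _ = (A.1 (Fin.last 0) : ℝ) * (T.ℓ₂.2 - yv z) := e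
      _ ≤ |(A.1 (Fin.last 0) : ℝ) * (T.ℓ₂.2 - yv z)| := le_abs_self _
      _ = |(A.1 (Fin.last 0) : ℝ)| * |yv z - T.ℓ₂.2| := by rw [abs_mul, abs_sub_comm]

/-- **A corner of the bottom on the wall** (`A > ρ` on the open interval, `A(y₀) = ρ` at an end
`y₀`, `ρ < τ`, pole at a positive distance, outer letter `κ ≤ ρ` or `κ > τ`):
`RebaseDiff.good_coreA_corner` with `α = |A′|`. [Kontsevich–Zagier 2001, §1.2, rules (1b), (2)] -/
theorem good_corner (h : IsDN s l u A (mk 0 τ) T p a i j) (hi : a i = some ci) (hj : a j = some cj)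
    (hcj : cj.1 (Fin.last 0) = 0) (hlam : ci.1 (Fin.last 0) ≠ 0) (h1 : T.n₁ = 0) (hn : T.n₂ = 1)
    (hK : Kc T p ≠ 0) (ρ : ℚ) (hρ : ρ = ci.2 - (0 - ci.1 (Fin.last 0)) * T.ℓ₂.2) (y₀ : ℝ)
    (hAy₀ : ev A y₀ = ρ) (hgt : ∀ y : ℝ, (l : ℝ) < y → y < u → (ρ : ℝ) < ev A y) (my : ℝ) (hmy : 0 < my)
    (hregy : ∀ y : ℝ, (l : ℝ) < y → y < u → my ≤ |y - T.ℓ₂.2|) (hκ : (cj.2 : ℝ) ≤ ρ ∨ (τ : ℝ) < cj.2) :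
    Good 2 (KZ.of s) := by
  have hlu : (l : ℝ) < u := by exact_mod_cast h.lu
  have hdiff : ∀ y : ℝ, ev A y - ev A y₀ = (A.1 (Fin.last 0) : ℝ) * (y - y₀) := fun y => by rw [ev, ev]; ring
  have hA' : (A.1 (Fin.last 0) : ℝ) ≠ 0 := fun h0 => by
    have hmid := hgt (((l : ℝ) + u) / 2) (by linarith) (by linarith)
    have := hdiff (((l : ℝ) + u) / 2)
    rw [h0, zero_mul, hAy₀] at this
    linarith
  obtain ⟨C, hC⟩ := exists_dom hκ
  refine good_coreA_corner s h.ne _ A τ T p a ci cj hi hj hcj h1 hn hlam h.bdd h.dom h.int ρ hρ y₀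
    |(A.1 (Fin.last 0) : ℝ)| my C (abs_pos.2 hA') hmy (fun z hz => ?_) (fun z hz => ?_)
    (tv_ne_inner h hi hj h1 hn hK) (fun z hz => ?_)
  · obtain ⟨⟨h1', h2'⟩, hA', -, -⟩ := (h.mem z).1 hz
    have hpos : 0 < (A.1 (Fin.last 0) : ℝ) * (yv z - y₀) := by
      rw [← hdiff, hAy₀, sub_pos]; exact hgt _ h1' h2'
    have hne0 : yv z - y₀ ≠ 0 := by
      rintro h0; rw [h0, mul_zero] at hpos; exact lt_irrefl _ hpos
    refine ⟨abs_pos.2 hne0, ?_⟩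
    calc |(A.1 (Fin.last 0) : ℝ)| * |yv z - y₀| = |(A.1 (Fin.last 0) : ℝ) * (yv z - y₀)| := (abs_mul _ _).symm
      _ = ev A (yv z) - ρ := by rw [abs_of_pos hpos, ← hdiff, hAy₀]
      _ < tv z i - ρ := by linarith
  · obtain ⟨⟨h1', h2'⟩, -⟩ := (h.mem z).1 hz
    exact hregy _ h1' h2'
  · obtain ⟨⟨h1', h2'⟩, hA', hij', hB'⟩ := (h.mem z).1 hz
    rw [ev_mk0] at hB'
    rw [ev_of_fst_eq_zero hcj]
    exact hC _ (by linarith [hgt _ h1' h2']) hB'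

/-- **A nest under the wall** (top = wall `ρ = cᵢ(r)`, pole at a positive distance, outer letter
`κ ≠ ρ`, non-zero base constant): the robust edge lemma `RebaseDiff.good_coreA_edge'` with the
alternative `exists_alt`. [Kontsevich–Zagier 2001, §1.2, rules (1b), (2)] -/
theorem good_lower {ρ : ℚ} (h : IsDN s l u A (mk 0 ρ) T p a i j) (hi : a i = some ci) (hj : a j = some cj)
    (hcj : cj.1 (Fin.last 0) = 0) (hlam : ci.1 (Fin.last 0) ≠ 0) (h1 : T.n₁ = 0) (hn : T.n₂ = 1)
    (hK : Kc T p ≠ 0) (hρ : ρ = ci.2 - (0 - ci.1 (Fin.last 0)) * T.ℓ₂.2) (hκρ : (cj.2 : ℝ) ≠ ρ)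
    (my : ℝ) (hmy : 0 < my) (hregy : ∀ y : ℝ, (l : ℝ) < y → y < u → my ≤ |y - T.ℓ₂.2|) :
    Good 2 (KZ.of s) := by
  obtain ⟨m₀, hm₀, halt⟩ := exists_alt hκρ
  refine good_coreA_edge' s h.ne _ A T p a ci cj hi hj hcj h1 hn hlam h.bdd ρ hρ h.dom h.int my m₀ hmy hm₀
    (fun z hz => ?_) (tv_ne_inner h hi hj h1 hn hK) (fun z hz => ?_)
  · obtain ⟨⟨h1', h2'⟩, -⟩ := (h.mem z).1 hz
    exact hregy _ h1' h2'
  · obtain ⟨-, -, hij', hB'⟩ := (h.mem z).1 hz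
    rw [ev_mk0] at hB'
    rw [ev_of_fst_eq_zero hcj]
    exact halt _ _ hij' hB'

end RebaseE2

/-- **Registered brick `rebaseSimpleZero_e2Lower` of the part `HPar1` (stub `stub_rebaseSimpleZeroTwo`,
line `janus-bands`): the LOWER piece of the E2 dissection.** A datum of the interval normal form
(`RebaseE1.IsDN`) in the normalised frame (outer letter constant `κ`, inner letter of slope
`λ ≠ 0`, non-zero base constant) whose constant TOP IS THE WALL `ρ = cᵢ(r)` of the edge expansion
of `tᵢ`, with `κ ≠ ρ` and the base pole at a positive distance from the interval, is congruent
modulo `KZ.relations` to the subgroup generated by `GG 0 2 2` (`RebaseE2.good_lower`: robust edge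
lemma). [Kontsevich–Zagier 2001, §1.2] -/
theorem rebaseSimpleZero_e2Lower (i j : Fin 2) (s : KZ.IntegralRep (0 + 1 + 2)) (l u : ℚ) (A ci cj : (Fin (0 + 1) → ℚ) × ℚ) (T : RebaseZero.BData) (p : MvPolynomial (Fin 0) ℚ) (a : Fin 2 → Option ((Fin (0 + 1) → ℚ) × ℚ)) (ρ : ℚ) (h : RebaseE1.IsDN s l u A (RebaseZero.mk 0 ρ) T p a i j) (hi : a i = some ci) (hj : a j = some cj) (hcj : cj.1 (Fin.last 0) = 0) (hlam : ci.1 (Fin.last 0) ≠ 0) (h1 : T.n₁ = 0) (hn : T.n₂ = 1) (hK : RebaseDiff.Kc T p ≠ 0) (hρ : ρ = ci.2 - (0 - ci.1 (Fin.last 0)) * T.ℓ₂.2) (hκρ : (cj.2 : ℝ) ≠ ρ) (my : ℝ) (hmy : 0 < my) (hregy : ∀ y : ℝ, (l : ℝ) < y → y < u → my ≤ |y - T.ℓ₂.2|) : ∃ c ∈ AddSubgroup.closure (SeparatePos.GGset 0 2 2), KZ.of s - c ∈ KZ.relations :=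
  RebaseE2.good_lower h hi hj hcj hlam h1 hn hK hρ hκρ my hmy hregy

end Summit.KontsevichZagierPeriods.ArrangementNormalForm.JanusBands
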